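import Summits.ValiantsHypothesis.ValiantsHypothesis.Theorems.SymPencilEquivariantSdcNotQPYoungFixedVectorAlternating
import Summits.ValiantsHypothesis.ValiantsHypothesis.Theorems.SymPencilEquivariantSdcNotQPPermEmbeddingOfYoungBounds
import HarnessLib

/-!
# ValiantsHypothesis / SymPencil — crux `EquivariantSdcNotQP` (stmt-ValiantsHypothesis-17792), line
# `birth_EquivariantSdcNotQP`, stub `stub_permify`: hypothesis (H2) `YoungFixedVector` REDUCED TO THE
# YOUNG-TABLEAUX DEGREE INEQUALITY (YD)

`youngFixedVector_of_degreeBound : (YD) → (H2)`, where (H2) is hypothesis `hYoung` of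
`permEmbeddingD_of_alternatingBounds` verbatim and
(YD) `∃ c, ∀ λ ⊢ n, ∃ ν ∈ {λ, λᵗ}, [𝔖_n : R_ν] ≤ 2^{(log₂ f^λ + log₂ n + c)^c}` is the purely
combinatorial degree inequality for standard Young tableaux (a form of the classical degree bounds for
`𝔖_n`, Rasala 1977 / James–Kerber 2.3.21: an irreducible `[λ]` of small degree `f^λ` has a long first row
or column, i.e. a Young subgroup of small index).  Proof (helper of the item,
`--supports stmt-ValiantsHypothesis-17792 --as helper`; 0 definitions, 0 named facts): pass to the
contragredient action `g ↦ (σ g⁻¹)ᵀ` on `ℂ^k` (a fixed VECTOR there is a fixed FUNCTIONAL for `σ`); apply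
`alternating_fixed_vector` to the first factor `𝔄_n × 1`, then to the second factor acting on the
(invariant, nonzero) subspace of `Y₁`-fixed vectors; `Y = Y₁ × Y₂`.
Corollaries: `permEmbeddingD_of_spinDichotomy_of_degreeBound : (H1) → (YD) → (D)` and
`permify_of_spinDichotomy_of_degreeBound : (H1) → (YD) → ⟨conclusion of stub_permify⟩`, so the residue of
`stub_permify` on the ledger is (H1) (Schur multiplier / spin degrees of `𝔄_n`) ∧ (YD) (tableaux
combinatorics).

Honest framing: (H1), (YD), `stub_permify`, the crux `SymPencil.EquivariantSdcNotQP` and `VP ≠ VNP`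
remain OPEN here; nothing in this file is progress on `VP ≠ VNP`.
-/

noncomputable section

set_option linter.dupNamespace false

namespace Summit.ValiantsHypothesis.ValiantsHypothesis.Theorems.SymPencilEquivariantSdcNotQP.YoungBounds

open Literature.NumberTheory.DiophantineGeometry Matrix

/-- Budget bookkeeping for the product: two factors `2^{(L+1+A+c)^c}` fit in `2^{(L+A+(c+2))^{c+2}}`.
[folklore] -/
theorem sq_budget_le (L A c : ℕ) :
    2 ^ ((L + 1 + A + c) ^ c) * 2 ^ ((L + 1 + A + c) ^ c) ≤ 2 ^ ((L + A + (c + 2)) ^ (c + 2)) := by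
  rw [← pow_add]
  refine Nat.pow_le_pow_right (by norm_num) ?_
  set x := L + 1 + A + c with hx
  have hx2 : L + A + (c + 2) = x + 1 := by omega
  rw [hx2, pow_add]
  have h1 : x ^ c ≤ (x + 1) ^ c := Nat.pow_le_pow_left (by omega) c
  have h2 : 2 ≤ (x + 1) ^ 2 := by nlinarith
  calc x ^ c + x ^ c = x ^ c * 2 := by ring
    _ ≤ (x + 1) ^ c * (x + 1) ^ 2 := Nat.mul_le_mul h1 h2

/-- **(H2) from the Young-tableaux degree inequality (YD).** [folklore] -/
theorem youngFixedVector_of_degreeBound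
    (hYD : ∃ c : ℕ, ∀ (n : ℕ) (lam : Nat.Partition n), ∃ ν : Nat.Partition n,
      (ν = lam ∨ ν = lam.transpose) ∧
        (rowStabilizer ν).index ≤ 2 ^ ((Nat.log 2 (numStandardTableaux lam) + Nat.log 2 n + c) ^ c)) :
    ∃ c : ℕ, ∀ (n k : ℕ)
      (σ : ↥(alternatingGroup (Fin n)) × ↥(alternatingGroup (Fin n)) →* GL (Fin k) ℂ), 1 ≤ k →
      ∃ Y : Subgroup (↥(alternatingGroup (Fin n)) × ↥(alternatingGroup (Fin n))),
        Y.index ≤ 2 ^ ((Nat.log 2 k + Nat.log 2 n + c) ^ c) ∧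
        ∃ ℓ : (Fin k → ℂ) →ₗ[ℂ] ℂ, ℓ ≠ 0 ∧
          ∀ y ∈ Y, ℓ ∘ₗ Matrix.toLin' (σ y : Matrix (Fin k) (Fin k) ℂ) = ℓ := by
  classical
  obtain ⟨c, hc⟩ := hYD
  refine ⟨c + 2, fun n k σ hk => ?_⟩
  set G := ↥(alternatingGroup (Fin n)) with hG
  -- the contragredient action on `ℂ^k`
  let ρ' : (G × G) →* ((Fin k → ℂ) →ₗ[ℂ] (Fin k → ℂ)) :=
    { toFun := fun g => Matrix.toLin' ((σ g⁻¹ : Matrix (Fin k) (Fin k) ℂ)ᵀ)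
      map_one' := by
        rw [inv_one, map_one, Units.val_one, Matrix.transpose_one, Matrix.toLin'_one]
        rfl
      map_mul' := fun g h => by
        rw [_root_.mul_inv_rev, map_mul, Units.val_mul, Matrix.transpose_mul, Matrix.toLin'_mul]
        rfl }
  have hρ' : ∀ g, ρ' g = Matrix.toLin' ((σ g⁻¹ : Matrix (Fin k) (Fin k) ℂ)ᵀ) := fun g => rfl
  -- budgets
  have hbudget : ∀ f : ℕ, f ≤ 2 * k →
      2 ^ ((Nat.log 2 f + Nat.log 2 n + c) ^ c) ≤ 2 ^ ((Nat.log 2 k + 1 + Nat.log 2 n + c) ^ c) := by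
    intro f hf
    refine Nat.pow_le_pow_right (by norm_num) (Nat.pow_le_pow_left ?_ c)
    have h1 : Nat.log 2 f ≤ Nat.log 2 (2 * k) := Nat.log_mono_right hf
    have h2 : Nat.log 2 (2 * k) = Nat.log 2 k + 1 := by
      rw [mul_comm]; exact Nat.log_mul_base one_lt_two (by omega)
    omega
  haveI : Nonempty (Fin k) := ⟨⟨0, hk⟩⟩
  -- first factor
  let ρ₁ : Representation ℂ G (Fin k → ℂ) := ρ'.comp (MonoidHom.inl G G)
  have hρ₁ : ∀ a : G, ρ₁ a = ρ' (a, 1) := fun a => rfl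
  obtain ⟨lam₁, hdim₁, hfix₁⟩ := alternating_fixed_vector n ρ₁
  rw [Module.finrank_fin_fun] at hdim₁
  obtain ⟨ν₁, hν₁, hidx₁⟩ := hc n lam₁
  obtain ⟨Y₁, hY₁, v, hv0, hv⟩ := hfix₁ ν₁ hν₁
  -- the subspace of `Y₁`-fixed vectors, invariant under the second factor
  let W : Submodule ℂ (Fin k → ℂ) :=
    { carrier := {w | ∀ y ∈ Y₁, ρ₁ y w = w}
      zero_mem' := by intro y _; simp
      add_mem' := by
        intro a b ha hb y hy
        rw [map_add, ha y hy, hb y hy]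
      smul_mem' := by
        intro r a ha y hy
        rw [map_smul, ha y hy] }
  have hW : ∀ w, w ∈ W ↔ ∀ y ∈ Y₁, ρ₁ y w = w := fun w => Iff.rfl
  have hcomm : ∀ (a b : G) (w : Fin k → ℂ), ρ' (a, 1) (ρ' (1, b) w) = ρ' (1, b) (ρ' (a, 1) w) := by
    intro a b w
    rw [← Module.End.mul_apply, ← map_mul, ← Module.End.mul_apply, ← map_mul]
    have h : ((a, 1) : G × G) * (1, b) = (1, b) * (a, 1) := by ext <;> simp
    rw [h]
  have hWinv : ∀ (b : G), ∀ w ∈ W, ρ' (1, b) w ∈ W := by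
    intro b w hw y hy
    rw [hρ₁, hcomm, ← hρ₁, hw y hy]
  let ρ₂ : Representation ℂ G W :=
    { toFun := fun b => (ρ' (1, b)).restrict (hWinv b)
      map_one' := by
        apply LinearMap.ext; intro w; apply Subtype.ext
        simp only [LinearMap.coe_restrict_apply, Module.End.one_apply]
        rw [show ((1 : G), (1 : G)) = (1 : G × G) from rfl, map_one, Module.End.one_apply]
      map_mul' := fun a b => by
        apply LinearMap.ext; intro w; apply Subtype.ext
        simp only [LinearMap.coe_restrict_apply, Module.End.mul_apply]
        rw [← Module.End.mul_apply, ← map_mul]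
        rfl }
  have hρ₂ : ∀ (b : G) (w : W), ((ρ₂ b w : W) : Fin k → ℂ) = ρ' (1, b) (w : Fin k → ℂ) :=
    fun b w => rfl
  haveI : Nontrivial W := ⟨⟨⟨v, (hW v).2 hv⟩, 0, fun h => hv0 (congrArg Subtype.val h)⟩⟩
  obtain ⟨lam₂, hdim₂, hfix₂⟩ := alternating_fixed_vector n ρ₂
  have hdim₂' : numStandardTableaux lam₂ ≤ 2 * k := by
    have : Module.finrank ℂ W ≤ k := by
      calc Module.finrank ℂ W ≤ Module.finrank ℂ (Fin k → ℂ) := Submodule.finrank_le W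
        _ = k := Module.finrank_fin_fun ℂ
    omega
  obtain ⟨ν₂, hν₂, hidx₂⟩ := hc n lam₂
  obtain ⟨Y₂, hY₂, w, hw0, hw⟩ := hfix₂ ν₂ hν₂
  -- the subgroup and the functional
  refine ⟨Y₁.prod Y₂, ?_, ?_⟩
  · rw [Subgroup.index_prod]
    calc Y₁.index * Y₂.index
        ≤ 2 ^ ((Nat.log 2 k + 1 + Nat.log 2 n + c) ^ c) * 2 ^ ((Nat.log 2 k + 1 + Nat.log 2 n + c) ^ c) :=
          Nat.mul_le_mul (hY₁.trans (hidx₁.trans (hbudget _ hdim₁)))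
            (hY₂.trans (hidx₂.trans (hbudget _ hdim₂')))
      _ ≤ 2 ^ ((Nat.log 2 k + Nat.log 2 n + (c + 2)) ^ (c + 2)) := sq_budget_le _ _ _
  · set wv : Fin k → ℂ := (w : Fin k → ℂ) with hwv
    have hwv0 : wv ≠ 0 := fun h => hw0 (Subtype.ext h)
    -- `wv` is fixed by `ρ' y` for every `y ∈ Y₁ × Y₂`
    have hfixed : ∀ y ∈ Y₁.prod Y₂, ρ' y wv = wv := by
      rintro ⟨y₁, y₂⟩ hy
      rw [Subgroup.mem_prod] at hy
      obtain ⟨hy₁, hy₂⟩ := hy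
      have h1 : ((y₁, y₂) : G × G) = (y₁, 1) * (1, y₂) := by ext <;> simp
      have h2 : ρ' (1, y₂) wv = wv := by
        have := congrArg Subtype.val (hw y₂ hy₂)
        rwa [hρ₂] at this
      have h3 : ρ' (y₁, 1) wv = wv := by rw [← hρ₁]; exact (hW wv).1 w.2 y₁ hy₁
      rw [h1, map_mul, Module.End.mul_apply, h2, h3]
    -- the functional `x ↦ wv ⬝ᵥ x`
    let ℓ : (Fin k → ℂ) →ₗ[ℂ] ℂ :=
      { toFun := fun x => wv ⬝ᵥ x
        map_add' := fun x y => dotProduct_add wv x y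
        map_smul' := fun r x => by rw [dotProduct_smul]; rfl }
    have hℓ : ∀ x, ℓ x = wv ⬝ᵥ x := fun x => rfl
    refine ⟨ℓ, ?_, fun y hy => ?_⟩
    · intro h
      apply hwv0
      funext i
      have := congrArg (fun f : (Fin k → ℂ) →ₗ[ℂ] ℂ => f (Pi.single i 1)) h
      simp only [hℓ, dotProduct_single, mul_one, LinearMap.zero_apply] at this
      exact this
    · have hyinv : ρ' y⁻¹ wv = wv := hfixed y⁻¹ (inv_mem hy)
      rw [hρ', inv_inv, Matrix.toLin'_apply, Matrix.mulVec_transpose] at hyinv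
      apply LinearMap.ext
      intro x
      rw [LinearMap.comp_apply, hℓ, hℓ, Matrix.toLin'_apply, Matrix.dotProduct_mulVec, hyinv]

/-- **(D) ⇐ (H1) ∧ (YD).**  With `youngFixedVector_of_degreeBound`, the hypothesis (H2) of
`permEmbeddingD_of_alternatingBounds` is replaced by the Young-tableaux degree inequality (YD).
Conditional; (H1), (YD) assumed. [folklore] -/
theorem permEmbeddingD_of_spinDichotomy_of_degreeBound
    (hExt : ∃ a : ℕ, ∀ (n k : ℕ) (E : Type) [Group E] [Finite E]
      (ψ : E →* ↥(alternatingGroup (Fin n)) × ↥(alternatingGroup (Fin n)))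
      (σ : E →* GL (Fin k) ℂ),
      Function.Surjective ψ →
      (∀ g : E, ψ g = 1 → ∃ c : ℂ,
        (σ g : Matrix (Fin k) (Fin k) ℂ) = c • (1 : Matrix (Fin k) (Fin k) ℂ)) →
      n ≤ a * (Nat.log 2 k + 1) ∨
        ∃ θ : E →* ℂˣ, ∀ g : E, ψ g = 1 →
          (σ g : Matrix (Fin k) (Fin k) ℂ) = ((θ g : ℂˣ) : ℂ) • (1 : Matrix (Fin k) (Fin k) ℂ))
    (hYD : ∃ c : ℕ, ∀ (n : ℕ) (lam : Nat.Partition n), ∃ ν : Nat.Partition n,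
      (ν = lam ∨ ν = lam.transpose) ∧
        (rowStabilizer ν).index ≤ 2 ^ ((Nat.log 2 (numStandardTableaux lam) + Nat.log 2 n + c) ^ c)) :
    ∃ d : ℕ, ∀ (n M k : ℕ) (G : Type) [Group G] [Finite G]
      (φ : G →* Equiv.Perm (Fin n) × Equiv.Perm (Fin n)) (ρ : G →* GL (Fin k) ℂ),
      Function.Surjective φ →
      (∀ g : G, φ g = 1 → ∃ c : ℂ, c ^ M = 1 ∧
        (ρ g : Matrix (Fin k) (Fin k) ℂ) = c • (1 : Matrix (Fin k) (Fin k) ℂ)) →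
      k ≤ M →
      (∀ W : Submodule ℂ (Fin k → ℂ),
        (∀ g : G, W ≤ W.comap (Matrix.toLin' (ρ g : Matrix (Fin k) (Fin k) ℂ))) → W = ⊥ ∨ W = ⊤) →
      ∃ m' ≤ 2 ^ ((Nat.log 2 M + Nat.log 2 n + d) ^ d),
        ∃ (ι : Matrix (Fin m') (Fin k) ℂ) (p : Matrix (Fin k) (Fin m') ℂ) (τ : G → Equiv.Perm (Fin m')),
          p * ι = 1 ∧ ∀ g : G,
            (τ g).permMatrix ℂ * ι = ι * (ρ g : Matrix (Fin k) (Fin k) ℂ) ∧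
            p * (τ g).permMatrix ℂ = (ρ g : Matrix (Fin k) (Fin k) ℂ) * p :=
  permEmbeddingD_of_alternatingBounds hExt (youngFixedVector_of_degreeBound hYD)

open MvPolynomial Literature.Computability.AlgebraicComplexity in
/-- **The conclusion of `stub_permify` ⇐ (H1) ∧ (YD).**  So after this file the registered residue of
`stub_permify` is: (H1) the spin dichotomy for `𝔄_n × 𝔄_n` (Schur multiplier `M(𝔄_n) = ℤ/2`,
Hoffman–Humphreys Thm. 2.11; spin degrees, Thm. 10.7) and (YD) the degree inequality for standard Young
tableaux — both classical, both assumed, neither in Mathlib.  Conditional; `stub_permify`, the crux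
`SymPencil.EquivariantSdcNotQP` and `VP ≠ VNP` remain OPEN. [folklore] -/
theorem permify_of_spinDichotomy_of_degreeBound
    (hExt : ∃ a : ℕ, ∀ (n k : ℕ) (E : Type) [Group E] [Finite E]
      (ψ : E →* ↥(alternatingGroup (Fin n)) × ↥(alternatingGroup (Fin n)))
      (σ : E →* GL (Fin k) ℂ),
      Function.Surjective ψ →
      (∀ g : E, ψ g = 1 → ∃ c : ℂ,
        (σ g : Matrix (Fin k) (Fin k) ℂ) = c • (1 : Matrix (Fin k) (Fin k) ℂ)) →
      n ≤ a * (Nat.log 2 k + 1) ∨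
        ∃ θ : E →* ℂˣ, ∀ g : E, ψ g = 1 →
          (σ g : Matrix (Fin k) (Fin k) ℂ) = ((θ g : ℂˣ) : ℂ) • (1 : Matrix (Fin k) (Fin k) ℂ))
    (hYD : ∃ c : ℕ, ∀ (n : ℕ) (lam : Nat.Partition n), ∃ ν : Nat.Partition n,
      (ν = lam ∨ ν = lam.transpose) ∧
        (rowStabilizer ν).index ≤ 2 ^ ((Nat.log 2 (numStandardTableaux lam) + Nat.log 2 n + c) ^ c)) :
    ∃ d : ℕ, ∀ (n m : ℕ) (A : Matrix (Fin m) (Fin m) (MvPolynomial (Fin n × Fin n) ℂ)),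
      A.IsSymm → IsEquivariantDetRepr (Subgroup.closure {γ : GL (Fin n × Fin n) ℂ |
        ∃ π ρ : Equiv.Perm (Fin n), (γ : Matrix (Fin n × Fin n) (Fin n × Fin n) ℂ) =
          Equiv.Perm.permMatrix ℂ (Equiv.prodCongr π ρ)}) (perPoly (Fin n) ℂ) A →
      ∃ m' ≤ 2 ^ ((Nat.log 2 m + d) ^ d),
        ∃ A' : Matrix (Fin m') (Fin m') (MvPolynomial (Fin n × Fin n) ℂ),
          IsAffineDetRepr (perPoly (Fin n) ℂ) A' ∧
          ∀ π ρ : Equiv.Perm (Fin n), ∃ σ : Equiv.Perm (Fin m'),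
            A'.map (MvPolynomial.rename fun ij : Fin n × Fin n => (π ij.1, ρ ij.2)) =
              (σ.permMatrix ℂ).map MvPolynomial.C * A' * ((σ.permMatrix ℂ)ᵀ).map MvPolynomial.C :=
  permify_of_alternatingBounds hExt (youngFixedVector_of_degreeBound hYD)

end Summit.ValiantsHypothesis.ValiantsHypothesis.Theorems.SymPencilEquivariantSdcNotQP.YoungBounds

end
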